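import Summits.ValiantsHypothesis.ValiantsHypothesis.Theorems.TwoProducts.RankTwoJacobianTower

/-!
# Rank three AFFINE, T1-A SETTLED: `nv (w₀^a·w₁^b − κ·w₂^d) ≤ 2·(4t⁶ + 5t² + 3t + 2) + 4`, uniformly in `a, b, d, κ`

SIDE-LADDER special case of the OPEN rung 3-AFF (`…Cruxes.TwoProducts.ValIdea35g10.RankThreeAffineLaw`, workfile rev 4): the BINOMIAL OUTER
POLYNOMIAL `X^a Y^b − κ Z^d` on three `t`-sparse carriers — the first THREE-LETTER affine instance (repeated letters, outside every
dissociation rung; `a + b = d` is the linear law ✓ `rankThreeLinearLaw`, `a + b ≠ d` was open).  crit-8 g4 T1 PRICE LIST 2026-08-29T06:03:38Z item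
T1-A, re-aimed by VERDICT #61/#62 (val-idea-35 g11's observation (J1)–(J3), paper + exact check `loc/jac_check.py` 30 891/30 891 — label: check,
not evidence); kernel = this file (val-port-4 g4; desk #535 (A)/#542 (E); director R398 (2)).  `--supports stmt-ValiantsHypothesis-5906 --as helper`.
NOT γ; `RankThreeAffineLaw` in general, `TwoProducts`, `PlanarCellBound`/`ResidualLawV25` UNMOVED; 0 summit distance; VP ≠ VNP is NOT proved here or
anywhere in this tree.  No instances, no notation, no named facts.

WHY IT IS EASY (honest structural note, crit-8 #61): the outer polynomial is SEPARATED, `Q(X,Y) − h(Z)` with `Q` a MONOMIAL.  The toric Jacobian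
`J(·, w₂)` is a derivation killing every polynomial in `w₂` (✓ `jac_self`), so for `N = w₀^a w₁^b − κ w₂^d`, `F = w₀^a w₁^b`:
`w₀·w₁·J(N, w₂) = F·Br`, `Br = a·w₁·J(w₀,w₂) + b·w₀·J(w₁,w₂)` (`≤ 2t³` monomials) — `κ` and `d` drop out.  Then the rung-2 tower
machinery of ✓ `…RankTwoJacobian{Axial,TowerExceptional,TowerSpecials,TowerInduction}` (val-idea-35 g9, ported by val-lit-p3 g18) in ONE step:
off the `≤ t² + t` exceptional chart values `Xc σ w₂`, ✓ `axialTransfer` turns an edge direction of `N` into a SPECIAL direction (`≤ 2(|Xc|+1)` by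
✓ `card_Spec_le`) or an edge direction of `J(N,w₂)`, hence (✓ `isEdgeDir_mul_left`, ✓ `ostrowski`) of `F` (i.e. of `w₀` or `w₁`) or of `Br`;
✓ `card_Eset_le`, ✓ `nv_le`.  Degenerate branches: `F = 0` (`N = −κw₂^d`, edges ⊆ edges of `w₂`); `w₂` constant (then `κw₂^d` is a constant and
`J(·, w₁)` resp. `J(·, w₀)` plays the role of `J(·, w₂)`); all carriers constant (`N` constant).
NEXT located instance where no carrier-derivation kills a term (crit-8 #61/#63, T1-A′): the FERMAT TRINOMIAL `w₀^a + λ·w₁^b − κ·w₂^d`. [folklore]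
-/

noncomputable section
set_option linter.dupNamespace false

namespace Summit.ValiantsHypothesis.ValiantsHypothesis.Theorems.TwoProducts.RankTwoJacobian

open scoped BigOperators Pointwise Classical
open MvPolynomial

/-! ### §1 Edge-direction sets of constants, negations, scalar multiples, products and powers -/

/-- A constant has no edge direction. [folklore] -/
theorem Eset_C (σ : ℝ) (c : ℂ) : Eset σ (C c : Poly2) = ∅ := by
  ext μ
  simp only [Finset.notMem_empty, iff_false]
  intro hμ
  unfold Eset at hμ
  obtain ⟨p, hp, q, hq, hpq, -, -⟩ := (Finset.mem_filter.mp hμ).2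
  have h0 : ∀ s ∈ (C c : Poly2).support, s = 0 := by
    intro s hs
    by_contra hne
    rw [MvPolynomial.mem_support_iff, coeff_C, if_neg (fun h => hne h.symm)] at hs
    exact hs rfl
  exact hpq ((h0 p hp).trans (h0 q hq).symm)

/-- `Eset` only depends on the support; negation does not change it. [folklore] -/
theorem Eset_neg (σ : ℝ) (A : Poly2) : Eset σ (-A) = Eset σ A := by
  unfold Eset EV; rw [MvPolynomial.support_neg]

/-- A nonzero scalar does not change `Eset`. [folklore] -/
theorem Eset_C_mul (σ : ℝ) {κ : ℂ} (hκ : κ ≠ 0) (A : Poly2) : Eset σ (C κ * A) = Eset σ A := by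
  have hs : (C κ * A).support = A.support := by
    ext s
    rw [MvPolynomial.mem_support_iff, MvPolynomial.mem_support_iff, coeff_C_mul, mul_ne_zero_iff]
    exact ⟨fun h => h.2, fun h => ⟨hκ, h⟩⟩
  unfold Eset EV; rw [hs]

/-- Edge directions of a product of nonzero polynomials come from the factors (✓ `ostrowski`). [folklore] -/
theorem Eset_mul_subset {σ : ℝ} (hσ : σ = 1 ∨ σ = -1) {F G : Poly2} (hF : F ≠ 0) (hG : G ≠ 0) :
    Eset σ (F * G) ⊆ Eset σ F ∪ Eset σ G := by
  intro μ hμ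
  rcases (ostrowski _ F G hF hG).mp ((mem_Eset hσ).mp hμ) with h | h
  · exact Finset.mem_union_left _ ((mem_Eset hσ).mpr h)
  · exact Finset.mem_union_right _ ((mem_Eset hσ).mpr h)

/-- Edge directions of a power come from the base. [folklore] -/
theorem Eset_pow_subset {σ : ℝ} (hσ : σ = 1 ∨ σ = -1) (A : Poly2) : ∀ n : ℕ, Eset σ (A ^ n) ⊆ Eset σ A
  | 0 => by
    intro μ hμ
    rw [pow_zero, ← C_1, Eset_C] at hμ
    simp at hμ
  | n + 1 => by
    by_cases hA : A = 0
    · intro μ hμ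
      rw [hA, zero_pow (Nat.succ_ne_zero n), Eset_zero] at hμ
      simp at hμ
    · rw [pow_succ]
      exact (Eset_mul_subset hσ (pow_ne_zero n hA) hA).trans (Finset.union_subset (Eset_pow_subset hσ A n) subset_rfl)

/-! ### §2 The one-step axial template -/

/-- **ONE-STEP AXIAL TEMPLATE.** If `v` is a non-constant carrier, `M ≠ 0` and `M·J(N, v) = F·Br`, then every edge direction of `N` in the chart `σ`
is an exceptional value of `v`, a special direction, or an edge direction of `F` or of `Br`
(✓ `axialTransfer` + ✓ `isEdgeDir_mul_left` + ✓ `ostrowski`). -/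
theorem Eset_subset_of_axial {σ : ℝ} (hσ : σ = 1 ∨ σ = -1) {v M N F Br : Poly2} (hv : (S1 v).Nonempty) (hM : M ≠ 0)
    (hid : M * jac N v = F * Br) : Eset σ N ⊆ Xc σ v ∪ Spec σ v N ∪ (Eset σ F ∪ Eset σ Br) := by
  intro μ hμ
  have hedge := (mem_Eset hσ).mp hμ
  by_cases hX : μ ∈ Xc σ v
  · exact Finset.mem_union_left _ (Finset.mem_union_left _ hX)
  obtain ⟨e, hlead⟩ := axialLead_of_not_mem hσ hv hX
  rcases axialTransfer (dir σ μ) N v e (ne_zero_of_isEdgeDir hedge) hlead hedge with hsp | hJ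
  · apply Finset.mem_union_left; apply Finset.mem_union_right
    unfold Spec
    exact Finset.mem_filter.mpr ⟨mem_EV_of_tie hσ hedge, hX, e, hlead, hsp⟩
  · have hMJ : IsEdgeDir (dir σ μ) (jac N v * M) := isEdgeDir_mul_left _ _ _ hM hJ
    rw [mul_comm, hid] at hMJ
    have hF : F ≠ 0 := fun h => ne_zero_of_isEdgeDir hMJ (by rw [h, zero_mul])
    have hBr : Br ≠ 0 := fun h => ne_zero_of_isEdgeDir hMJ (by rw [h, mul_zero])
    apply Finset.mem_union_right
    rcases (ostrowski _ F Br hF hBr).mp hMJ with h | h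
    · exact Finset.mem_union_left _ ((mem_Eset hσ).mpr h)
    · exact Finset.mem_union_right _ ((mem_Eset hσ).mpr h)

/-! ### §3 Jacobian identities: `J(·, v)` kills polynomials in `v`; `w₀·w₁·J(w₀^a w₁^b, v) = w₀^a w₁^b·Br` -/

/-- `J(A·B, v) = A·J(B,v) + B·J(A,v)` (Leibniz for the derivation ✓ `jacDer v`). [folklore] -/
theorem jac_mul_left (A B v : Poly2) : jac (A * B) v = A * jac B v + B * jac A v := by
  rw [← jacDer_apply, ← jacDer_apply, ← jacDer_apply, (jacDer v).leibniz, smul_eq_mul, smul_eq_mul]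

/-- `J(1, v) = 0`. [folklore] -/
theorem jac_one_left (v : Poly2) : jac 1 v = 0 := by
  rw [← jacDer_apply, (jacDer v).map_one_eq_zero]

/-- `J(C c, v) = 0`. [folklore] -/
theorem jac_C_left (c : ℂ) (v : Poly2) : jac (C c) v = 0 := by
  rw [← jacDer_apply, ← mul_one (C c), ← smul_eq_C_mul, (jacDer v).map_smul, (jacDer v).map_one_eq_zero, smul_zero]

/-- `J(A − B, v) = J(A,v) − J(B,v)`. [folklore] -/
theorem jac_sub_left (A B v : Poly2) : jac (A - B) v = jac A v - jac B v := by
  rw [← jacDer_apply, ← jacDer_apply, ← jacDer_apply, map_sub]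

/-- **`J(A^n, v)·A = n·A^n·J(A, v)`** (no `ℕ`-subtraction). [folklore] -/
theorem jac_pow_mul (A v : Poly2) : ∀ n : ℕ, jac (A ^ n) v * A = C (n : ℂ) * (A ^ n * jac A v)
  | 0 => by rw [pow_zero, jac_one_left, zero_mul, Nat.cast_zero, C_0, zero_mul]
  | n + 1 => by
    rw [pow_succ, jac_mul_left]
    have ih := jac_pow_mul A v n
    push_cast
    rw [map_add, map_one]
    linear_combination A * ih

/-- `J(κ·v^d, v) = 0`: `J(·, v)` kills every polynomial in `v` (✓ `jac_self`). [folklore] -/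
theorem jac_C_mul_pow_self (κ : ℂ) (v : Poly2) (d : ℕ) : jac (C κ * v ^ d) v = 0 := by
  rcases Nat.eq_zero_or_pos d with rfl | hd
  · rw [pow_zero, mul_one, jac_C_left]
  · by_cases hv : v = 0
    · rw [hv, zero_pow hd.ne', mul_zero]
      have h := jac_C_left 0 (0 : Poly2)
      rwa [C_0] at h
    · rw [jac_mul_left, jac_C_left, mul_zero, add_zero]
      have h := jac_pow_mul v v d
      rw [jac_self, mul_zero, mul_zero] at h
      -- `jac (v^d) v * v = 0` and `v ≠ 0` ⇒ `jac (v^d) v = 0`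
      have : jac (v ^ d) v = 0 := (mul_eq_zero.mp h).resolve_right hv
      rw [this, mul_zero]

/-- **THE BRACKET IDENTITY**: `w₀·w₁·J(w₀^a·w₁^b, v) = (w₀^a·w₁^b)·(a·w₁·J(w₀,v) + b·w₀·J(w₁,v))`. [folklore] -/
theorem bracket_identity (w₀ w₁ v : Poly2) (a b : ℕ) :
    w₀ * w₁ * jac (w₀ ^ a * w₁ ^ b) v =
      (w₀ ^ a * w₁ ^ b) * (C (a : ℂ) * (w₁ * jac w₀ v) + C (b : ℂ) * (w₀ * jac w₁ v)) := by
  rw [jac_mul_left]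
  have h0 := jac_pow_mul w₀ v a
  have h1 := jac_pow_mul w₁ v b
  linear_combination w₁ * w₁ ^ b * h0 + w₀ * w₀ ^ a * h1

/-- Size of the bracket: `|supp Br| ≤ 2·t₀·t₁·t_v`. [folklore] -/
theorem card_support_bracket_le (w₀ w₁ v : Poly2) (a b : ℕ) :
    (C (a : ℂ) * (w₁ * jac w₀ v) + C (b : ℂ) * (w₀ * jac w₁ v)).support.card ≤
      2 * (w₀.support.card * w₁.support.card * v.support.card) := by
  have hC : ∀ (c : ℂ) (X : Poly2), (C c * X).support.card ≤ X.support.card := by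
    intro c X
    refine Finset.card_le_card fun s hs => ?_
    rw [MvPolynomial.mem_support_iff, coeff_C_mul] at hs
    exact MvPolynomial.mem_support_iff.mpr (right_ne_zero_of_mul hs)
  have hmul : ∀ X Y : Poly2, (X * Y).support.card ≤ X.support.card * Y.support.card := fun X Y =>
    (Finset.card_le_card (MvPolynomial.support_mul X Y)).trans Finset.card_add_le
  have h1 : (C (a : ℂ) * (w₁ * jac w₀ v)).support.card ≤ w₀.support.card * w₁.support.card * v.support.card :=
    (hC _ _).trans ((hmul _ _).trans (by
      have := card_support_jac_le w₀ v
      calc w₁.support.card * (jac w₀ v).support.card ≤ w₁.support.card * (w₀.support.card * v.support.card) :=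
            Nat.mul_le_mul_left _ this
        _ = w₀.support.card * w₁.support.card * v.support.card := by ring))
  have h2 : (C (b : ℂ) * (w₀ * jac w₁ v)).support.card ≤ w₀.support.card * w₁.support.card * v.support.card :=
    (hC _ _).trans ((hmul _ _).trans (by
      have := card_support_jac_le w₁ v
      calc w₀.support.card * (jac w₁ v).support.card ≤ w₀.support.card * (w₁.support.card * v.support.card) :=
            Nat.mul_le_mul_left _ this
        _ = w₀.support.card * w₁.support.card * v.support.card := by ring))
  calc (C (a : ℂ) * (w₁ * jac w₀ v) + C (b : ℂ) * (w₀ * jac w₁ v)).support.card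
      ≤ ((C (a : ℂ) * (w₁ * jac w₀ v)).support ∪ (C (b : ℂ) * (w₀ * jac w₁ v)).support).card :=
        Finset.card_le_card (MvPolynomial.support_add)
    _ ≤ 2 * (w₀.support.card * w₁.support.card * v.support.card) := (Finset.card_union_le _ _).trans (by omega)

/-- `t² ≤ 2t³` in `ℕ`. [folklore] -/
theorem sq_le_two_cube (t : ℕ) : t * t ≤ 2 * t ^ 3 := by
  rcases Nat.eq_zero_or_pos t with rfl | ht
  · simp
  · have h : t * t * 1 ≤ t * t * t := Nat.mul_le_mul_left _ ht
    nlinarith [h]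

/-- The multiplier/bracket data for `F = w₀^a·w₁^b ≠ 0` and ANY carrier `v`: some `M ≠ 0` and `Br` with `M·J(F,v) = F·Br` and
`|supp Br| ≤ 2·t³` (the degenerate `w₀ = 0` / `w₁ = 0` corners use one carrier or none). [folklore] -/
theorem exists_multiplier {t : ℕ} (w₀ w₁ v : Poly2) (h0 : w₀.support.card ≤ t) (h1 : w₁.support.card ≤ t)
    (hv : v.support.card ≤ t) (a b : ℕ) (hF : w₀ ^ a * w₁ ^ b ≠ 0) :
    ∃ M Br : Poly2, M ≠ 0 ∧ M * jac (w₀ ^ a * w₁ ^ b) v = (w₀ ^ a * w₁ ^ b) * Br ∧ Br.support.card ≤ 2 * t ^ 3 := by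
  by_cases hw0 : w₀ = 0
  · have ha : a = 0 := by
      by_contra ha; exact hF (by rw [hw0, zero_pow ha, zero_mul])
    by_cases hw1 : w₁ = 0
    · have hb : b = 0 := by
        by_contra hb; exact hF (by rw [hw1, zero_pow hb, mul_zero])
      refine ⟨1, 0, one_ne_zero, ?_, by simp⟩
      simp [ha, hb, jac_one_left]
    · refine ⟨w₁, C (b : ℂ) * jac w₁ v, hw1, ?_, ?_⟩
      · rw [ha, pow_zero, one_mul, mul_comm, jac_pow_mul]; ring
      · refine (Finset.card_le_card fun s hs => ?_).trans ((card_support_jac_le w₁ v).trans ?_)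
        · rw [MvPolynomial.mem_support_iff, coeff_C_mul] at hs
          exact MvPolynomial.mem_support_iff.mpr (right_ne_zero_of_mul hs)
        · calc w₁.support.card * v.support.card ≤ t * t := Nat.mul_le_mul h1 hv
            _ ≤ 2 * t ^ 3 := sq_le_two_cube t
  by_cases hw1 : w₁ = 0
  · have hb : b = 0 := by
      by_contra hb; exact hF (by rw [hw1, zero_pow hb, mul_zero])
    refine ⟨w₀, C (a : ℂ) * jac w₀ v, hw0, ?_, ?_⟩
    · rw [hb, pow_zero, mul_one, mul_comm, jac_pow_mul]; ring
    · refine (Finset.card_le_card fun s hs => ?_).trans ((card_support_jac_le w₀ v).trans ?_)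
      · rw [MvPolynomial.mem_support_iff, coeff_C_mul] at hs
        exact MvPolynomial.mem_support_iff.mpr (right_ne_zero_of_mul hs)
      · calc w₀.support.card * v.support.card ≤ t * t := Nat.mul_le_mul h0 hv
          _ ≤ 2 * t ^ 3 := sq_le_two_cube t
  refine ⟨w₀ * w₁, C (a : ℂ) * (w₁ * jac w₀ v) + C (b : ℂ) * (w₀ * jac w₁ v), mul_ne_zero hw0 hw1,
    bracket_identity w₀ w₁ v a b, (card_support_bracket_le w₀ w₁ v a b).trans ?_⟩
  calc 2 * (w₀.support.card * w₁.support.card * v.support.card) ≤ 2 * (t * t * t) :=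
        Nat.mul_le_mul_left 2 (Nat.mul_le_mul (Nat.mul_le_mul h0 h1) hv)
    _ = 2 * t ^ 3 := by ring

/-! ### §4 The per-chart count and the headline -/

/-- Per-chart count behind the template: `|Eset σ N| ≤ (t² + t) + 2(t² + t + 1) + 2t² + 4t⁶`. -/
theorem card_Eset_le_of_axial {σ : ℝ} (hσ : σ = 1 ∨ σ = -1) {t : ℕ} (w₀ w₁ v N Br M : Poly2) (a b : ℕ)
    (h0 : w₀.support.card ≤ t) (h1 : w₁.support.card ≤ t) (hv : v.support.card ≤ t) (hS : (S1 v).Nonempty) (hM : M ≠ 0)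
    (hF : w₀ ^ a * w₁ ^ b ≠ 0) (hid : M * jac N v = (w₀ ^ a * w₁ ^ b) * Br) (hBr : Br.support.card ≤ 2 * t ^ 3) :
    (Eset σ N).card ≤ 4 * t ^ 6 + 5 * t ^ 2 + 3 * t + 2 := by
  have hsub := Eset_subset_of_axial hσ hS hM hid
  have hw0 : w₀ ^ a ≠ 0 := fun h => hF (by rw [h, zero_mul])
  have hw1 : w₁ ^ b ≠ 0 := fun h => hF (by rw [h, mul_zero])
  have hFsub : Eset σ (w₀ ^ a * w₁ ^ b) ⊆ Eset σ w₀ ∪ Eset σ w₁ :=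
    (Eset_mul_subset hσ hw0 hw1).trans (Finset.union_subset_union (Eset_pow_subset hσ w₀ a) (Eset_pow_subset hσ w₁ b))
  have hX : (Xc σ v).card ≤ t * t + t := (card_Xc_le σ v).trans (Nat.add_le_add (Nat.mul_le_mul hv hv) hv)
  have hSp : (Spec σ v N).card ≤ 2 * ((Xc σ v).card + 1) := card_Spec_le hσ v N
  have hE0 : (Eset σ w₀).card ≤ t * t := (card_Eset_le σ w₀).trans (Nat.mul_le_mul h0 h0)
  have hE1 : (Eset σ w₁).card ≤ t * t := (card_Eset_le σ w₁).trans (Nat.mul_le_mul h1 h1)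
  have hEB : (Eset σ Br).card ≤ (2 * t ^ 3) * (2 * t ^ 3) := (card_Eset_le σ Br).trans (Nat.mul_le_mul hBr hBr)
  have hcard := (Finset.card_le_card (hsub.trans (Finset.union_subset_union subset_rfl
    (Finset.union_subset_union hFsub subset_rfl)))).trans
    ((Finset.card_union_le _ _).trans (Nat.add_le_add ((Finset.card_union_le _ _))
      ((Finset.card_union_le _ _).trans (Nat.add_le_add (Finset.card_union_le _ _) le_rfl))))
  have e6 : (2 * t ^ 3) * (2 * t ^ 3) = 4 * t ^ 6 := by ring
  rw [e6] at hEB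
  have htt : t * t = t ^ 2 := by ring
  rw [htt] at hX hE0 hE1
  omega

/-- ★ **Per chart: `|Eset σ (w₀^a·w₁^b − κ·w₂^d)| ≤ 4t⁶ + 5t² + 3t + 2`.** -/
theorem card_Eset_binomialAffine_le {σ : ℝ} (hσ : σ = 1 ∨ σ = -1) {t : ℕ} (w : Fin 3 → Poly2)
    (hw : ∀ i, (w i).support.card ≤ t) (a b d : ℕ) (κ : ℂ) :
    (Eset σ (w 0 ^ a * w 1 ^ b - C κ * w 2 ^ d)).card ≤ 4 * t ^ 6 + 5 * t ^ 2 + 3 * t + 2 := by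
  have ht2 : (Eset σ (w 2)).card ≤ 4 * t ^ 6 + 5 * t ^ 2 + 3 * t + 2 := by
    have := (card_Eset_le σ (w 2)).trans (Nat.mul_le_mul (hw 2) (hw 2))
    nlinarith [Nat.zero_le (t ^ 6), Nat.zero_le t]
  -- F = 0: `N = −κ w₂^d`
  by_cases hF : w 0 ^ a * w 1 ^ b = 0
  · rw [hF, zero_sub, Eset_neg]
    by_cases hκ : κ = 0
    · rw [hκ, C_0, zero_mul, Eset_zero]; simp
    · rw [Eset_C_mul σ hκ]
      exact (Finset.card_le_card (Eset_pow_subset hσ (w 2) d)).trans ht2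
  -- the axial carrier: `w 2` if non-constant, else `w 1`, else `w 0`, else everything is constant
  by_cases hS2 : (S1 (w 2)).Nonempty
  · obtain ⟨M, Br, hM, hid, hBr⟩ := exists_multiplier (w 0) (w 1) (w 2) (hw 0) (hw 1) (hw 2) a b hF
    refine card_Eset_le_of_axial hσ (w 0) (w 1) (w 2) _ Br M a b (hw 0) (hw 1) (hw 2) hS2 hM hF ?_ hBr
    rw [jac_sub_left, jac_C_mul_pow_self, sub_zero, hid]
  -- `w 2` is a constant: the subtracted term is a constant and ANY carrier-derivation kills it
  have hw2 : w 2 = C (coeff 0 (w 2)) := eq_C_of_S1_empty hS2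
  have hG : C κ * w 2 ^ d = C (κ * coeff 0 (w 2) ^ d) := by rw [hw2, ← map_pow, ← map_mul, coeff_C, if_pos rfl]
  by_cases hS1 : (S1 (w 1)).Nonempty
  · obtain ⟨M, Br, hM, hid, hBr⟩ := exists_multiplier (w 0) (w 1) (w 1) (hw 0) (hw 1) (hw 1) a b hF
    refine card_Eset_le_of_axial hσ (w 0) (w 1) (w 1) _ Br M a b (hw 0) (hw 1) (hw 1) hS1 hM hF ?_ hBr
    rw [hG, jac_sub_left, jac_C_left, sub_zero, hid]
  by_cases hS0 : (S1 (w 0)).Nonempty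
  · obtain ⟨M, Br, hM, hid, hBr⟩ := exists_multiplier (w 0) (w 1) (w 0) (hw 0) (hw 1) (hw 0) a b hF
    refine card_Eset_le_of_axial hσ (w 0) (w 1) (w 0) _ Br M a b (hw 0) (hw 1) (hw 0) hS0 hM hF ?_ hBr
    rw [hG, jac_sub_left, jac_C_left, sub_zero, hid]
  -- all three carriers constant ⇒ `N` constant
  have hw1 : w 1 = C (coeff 0 (w 1)) := eq_C_of_S1_empty hS1
  have hw0 : w 0 = C (coeff 0 (w 0)) := eq_C_of_S1_empty hS0
  have hN : w 0 ^ a * w 1 ^ b - C κ * w 2 ^ d = C (coeff 0 (w 0) ^ a * coeff 0 (w 1) ^ b - κ * coeff 0 (w 2) ^ d) := by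
    rw [hG, hw0, hw1, coeff_C, coeff_C, if_pos rfl, if_pos rfl, ← map_pow, ← map_pow, ← map_mul, ← map_sub]
  rw [hN, Eset_C]
  simp

/-- ★★ **T1-A SETTLED (uniform).** For `t`-sparse carriers `w₀, w₁, w₂ ∈ ℂ[x,y]` and ANY `a, b, d : ℕ`, `κ : ℂ`:
`nv (w₀^a·w₁^b − κ·w₂^d) ≤ 2·(4t⁶ + 5t² + 3t + 2) + 4`. -/
theorem binomialAffine_nv_le {t : ℕ} (w : Fin 3 → Poly2) (hw : ∀ i, (w i).support.card ≤ t) (a b d : ℕ) (κ : ℂ) :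
    nv (w 0 ^ a * w 1 ^ b - C κ * w 2 ^ d) ≤ 2 * (4 * t ^ 6 + 5 * t ^ 2 + 3 * t + 2) + 4 := by
  have h1 := card_Eset_binomialAffine_le (σ := 1) (Or.inl rfl) w hw a b d κ
  have h2 := card_Eset_binomialAffine_le (σ := -1) (Or.inr rfl) w hw a b d κ
  have h := nv_le (w 0 ^ a * w 1 ^ b - C κ * w 2 ^ d)
  omega

/-- The binomial-outer-polynomial law (crit-8 g4's T1-A verbatim): `nv (w₀^a w₁^b − κ w₂^d) ≤ (a+b+d+2)^c (t+2)^c` for some absolute `c`.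
PROVED below (`binomialAffineLaw`, `c = 7`) — in fact uniformly in `a, b, d, κ` (`binomialAffine_nv_le`). -/
def BinomialAffineLaw : Prop :=
  ∃ c : ℕ, ∀ (a b d t : ℕ) (κ : ℂ) (w : Fin 3 → Poly2), (∀ i, (w i).support.card ≤ t) →
    nv (w 0 ^ a * w 1 ^ b - C κ * w 2 ^ d) ≤ (a + b + d + 2) ^ c * (t + 2) ^ c

/-- Arithmetic: `2·(4t⁶ + 5t² + 3t + 2) + 4 ≤ (t+2)^7`. [folklore] -/
theorem binomial_arith (t : ℕ) : 2 * (4 * t ^ 6 + 5 * t ^ 2 + 3 * t + 2) + 4 ≤ (t + 2) ^ 7 := by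
  have e : (t + 2) ^ 7 = t ^ 7 + 14 * t ^ 6 + 84 * t ^ 5 + 280 * t ^ 4 + 560 * t ^ 3 + 672 * t ^ 2 + 448 * t + 128 := by ring
  rw [e]
  nlinarith [Nat.zero_le (t ^ 7), Nat.zero_le (t ^ 6), Nat.zero_le (t ^ 5), Nat.zero_le (t ^ 4), Nat.zero_le (t ^ 3),
    Nat.zero_le (t ^ 2), Nat.zero_le t]

/-- ★ **`BinomialAffineLaw` holds** (`c = 7`; the uniform bound dominates). -/
theorem binomialAffineLaw : BinomialAffineLaw := by
  refine ⟨7, fun a b d t κ w hw => (binomialAffine_nv_le w hw a b d κ).trans ((binomial_arith t).trans ?_)⟩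
  exact Nat.le_mul_of_pos_left _ (pow_pos (by omega) 7)

end Summit.ValiantsHypothesis.ValiantsHypothesis.Theorems.TwoProducts.RankTwoJacobian

end
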